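import Mathlib
import Summits.Ventures.HodgeRepro2.T6NAut3
import Summits.Ventures.HodgeRepro2.T6N42Main
import Summits.Ventures.HodgeRepro2.T6N42Toy

/-!
# T6N42Rich — the N4.2 finite-places datum WITH ITS STANDING FACTS as construction fields: the
«rich datum» of the N4.2 block (owner t6-p5; the lead's rich-datum pattern of STATUS l. 11500 (1)
for N5 / t6-p6's Bergman pattern, applied to N4.2; count-neutral, carrier-free, nothing on the v6
line changes)

On the M2 v6 line (`periodInputN_of_published₆`, T6PeriodInput6 p407424) the N4.2 block costs, per
side, FOUR residual binders of class AD on the side's finite-places datum `M.sA.d42` (resp. `sB`):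
`hIS : IrreducibleSmooth` (`π₀,v` irreducible and smooth at every finite place), `hpos : ∀ v, 0 <
(splitDatum v).n`, `hnm : TypeIISizes` (`n ≤ m`, `(2, 3)` for `(GL₂, GL₃)`) and `hFL : FirstLift`
(TIER5 §B's standing datum «`π₀,v = θ_{W₁₂,v}(β′_v)`» at the non-split places) — the hypotheses the
two displayed local theorems (Mínguez 2008 Thm. 1(2), Gan–Ichino 2014 Prop. 5.3(i)) take of the
datum, all of them FACTS OF THE DATUM'S CONSTRUCTION (the local components of the automorphic
representation `π₀` of (N0.3) and the fixed dual pairs), none a printed conclusion. This file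
packages the datum WITH those facts as `N42Rich` (the lead's pattern: a rich datum whose
`toDatum` is the carrier's field), so that a composition consumes the N4.2 block through ONE
construction binder per side, `(R : N42Rich) (hR : M.sA.d42 = R.toDatum)`, with the four Props
THEOREMS (`irreducibleSmooth_of_eq`, `pos_of_eq`, `typeIISizes_of_eq`, `firstLift_of_eq`) and
`N42_main` applied through them (`thetaNonzeroEverywhere_of_eq`); on the lead's carrier `NAut3`:
`N42_side_rich₃ M R hR hM hGI : M.sA.d42.ThetaNonzeroEverywhere` (side A; `N42_sideB_rich₃` for B)
and the four-Prop bundle `props_rich₃`.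

CENSUS EFFECT (for the lead's hour only — l. 11500 (1)(c): a v7 is the lead's call AFTER the
§10.5(ii)(d) declaration on v6, on the criterion of a shrinking residual census): the N4.2 binders
`hIS hpos hnm hFL` [AD ×4 per side, 8 in all] of v6 would be replaced by `(R42A : N42Rich)
(hR42A : M.sA.d42 = R42A.toDatum)` and the same on side B [EX ×2 per side, construction: the datum
is the datum with its standing facts] — AD −8, EX +4, binders −4; the two displays per side
`hM hGI` UNCHANGED (consumed as on v6); `N4_main` UNCHANGED (its four Props are supplied by the
`_of_eq` theorems in the proof term). NOT a display, NOT new mathematics: every proof is a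
projection of the structure or `N42Main.N42_main`. The declared M2 object stays v6; this file is
consumed by nothing on the v6 line.

INSTANCE (§10.5(ii)(c)/(d), so that a re-point of the joint toy is mechanical): `N42Rich.toy` on
`N42Toy.toyFinitePlaces` with the four facts as landed in T6N42Toy — `toy.toDatum = toyFinitePlaces`
by `rfl`; the joint toys' sides (`N42ToyNSide.toyNSide`, t6-p6's `N43Toy.bergmanNSide` — the `sA = sB`
of t6-p6's (γ) T6PeriodInput6Toy2) have `d42 = toyFinitePlaces` by `rfl`, so there `hR` is `rfl`.

README §8(d): uses an L-value-free non-vanishing device: NO (TIER5 §G / N4.2, a pre-02:16Z line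
of record, continued; the non-vanishing inputs of N4 stay Gan–Ichino / Mínguez as printed).
-/

namespace Summit.Ventures.HodgeRepro2.T6

open Summit.Ventures.HodgeRepro2
open Summit.Ventures.HodgeRepro2.T6.N42Defs
open Summit.Ventures.HodgeRepro2.T6.N42Datum
open Summit.Ventures.HodgeRepro2.T6.N42Main
open Summit.Ventures.HodgeRepro2.T6.N42Toy

/-- THE N4.2 RICH DATUM: the finite-places datum of record (`N42Datum.FinitePlacesDatum`: the split
/ non-split finite places, the type II data, the Witt towers, `β′_v`, the zeta data) TOGETHER WITH
its standing facts — `π₀,v` irreducible smooth everywhere, `n > 0` and `n ≤ m` at the split places,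
the first lift `π₀,v = θ(β′_v)` at the non-split places — as construction fields. Data + the
construction's facts only; no display; no conclusion of N4.2 is a field. -/
structure N42Rich where
  /-- The finite-places datum (the carrier's field `d42`). -/
  d : FinitePlacesDatum
  /-- `π₀,v` is irreducible and smooth at every finite place (split and non-split). -/
  irreducibleSmooth : d.IrreducibleSmooth
  /-- `0 < n` at the split places (`n = 2`). -/
  pos : ∀ v, 0 < (d.splitDatum v).n
  /-- `n ≤ m` at the split places (`(n, m) = (2, 3)`). -/
  typeIISizes : d.TypeIISizes
  /-- The first lift at the non-split places: `Hom_{G(W)×H(V₀)}(ω_{V₀}, π₀,v ⊠ β′_v) ≠ 0`. -/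
  firstLift : d.FirstLift

namespace N42Rich

variable (R : N42Rich)

/-- The datum the carrier holds (`R.d`). -/
def toDatum : FinitePlacesDatum := R.d

/-- `toDatum` is the field (`rfl`). -/
theorem toDatum_eq : R.toDatum = R.d := rfl

/-! ### The four Props and `N42_main` through an equation with the carrier's field -/

/-- `IrreducibleSmooth` of a datum equal to `R.toDatum`. -/
theorem irreducibleSmooth_of_eq {D : FinitePlacesDatum} (hR : D = R.toDatum) :
    D.IrreducibleSmooth := by
  rw [hR]; exact R.irreducibleSmooth

/-- `0 < n` at the split places of a datum equal to `R.toDatum`. -/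
theorem pos_of_eq {D : FinitePlacesDatum} (hR : D = R.toDatum) : ∀ v, 0 < (D.splitDatum v).n := by
  rw [hR]; exact R.pos

/-- `TypeIISizes` of a datum equal to `R.toDatum`. -/
theorem typeIISizes_of_eq {D : FinitePlacesDatum} (hR : D = R.toDatum) : D.TypeIISizes := by
  rw [hR]; exact R.typeIISizes

/-- `FirstLift` of a datum equal to `R.toDatum`. -/
theorem firstLift_of_eq {D : FinitePlacesDatum} (hR : D = R.toDatum) : D.FirstLift := by
  rw [hR]; exact R.firstLift

/-- The four Props of v6's N4.2 block at once, from the construction binder. -/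
theorem props_of_eq {D : FinitePlacesDatum} (hR : D = R.toDatum) :
    D.IrreducibleSmooth ∧ (∀ v, 0 < (D.splitDatum v).n) ∧ D.TypeIISizes ∧ D.FirstLift :=
  ⟨R.irreducibleSmooth_of_eq hR, R.pos_of_eq hR, R.typeIISizes_of_eq hR, R.firstLift_of_eq hR⟩

/-- `N42_main` ON THE RICH DATUM: the two displays (Mínguez at the split places, Gan–Ichino at the
non-split places) give `ThetaNonzeroEverywhere` — the four datum Props are the structure's fields. -/
theorem thetaNonzeroEverywhere (hM : ∀ v, Hyp.Minguez2008_Theoreme1_2 (R.d.splitDatum v))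
    (hGI : ∀ v, Hyp.GanIchino2014_Prop5_3_i (R.d.towerDatum v)) : R.d.ThetaNonzeroEverywhere :=
  N42_main R.d R.irreducibleSmooth R.pos R.typeIISizes R.firstLift hM hGI

/-- `N42_main` on a datum equal to `R.toDatum`: the N4.2 conclusion from the two displays and the
one construction binder. -/
theorem thetaNonzeroEverywhere_of_eq {D : FinitePlacesDatum} (hR : D = R.toDatum)
    (hM : ∀ v, Hyp.Minguez2008_Theoreme1_2 (D.splitDatum v))
    (hGI : ∀ v, Hyp.GanIchino2014_Prop5_3_i (D.towerDatum v)) : D.ThetaNonzeroEverywhere :=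
  N42_main D (R.irreducibleSmooth_of_eq hR) (R.pos_of_eq hR) (R.typeIISizes_of_eq hR)
    (R.firstLift_of_eq hR) hM hGI

/-! ### On the lead's carrier `NAut3` (side A = `M.sA`, side B = `M.sB`) -/

variable {K : Type*} [Field K] [NumberField K] [NumberField.IsCMField K]
variable {F : FaceSetting K} {P : NDatum F}

/-- The four Props of v6's N4.2 block on side A from the construction binder `hR`. -/
theorem props_rich₃ (M : NAut3 F P) (hR : M.sA.d42 = R.toDatum) :
    M.sA.d42.IrreducibleSmooth ∧ (∀ v, 0 < (M.sA.d42.splitDatum v).n) ∧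
      M.sA.d42.TypeIISizes ∧ M.sA.d42.FirstLift :=
  R.props_of_eq hR

/-- The four Props of v6's N4.2 block on side B from the construction binder `hR`. -/
theorem propsB_rich₃ (M : NAut3 F P) (hR : M.sB.d42 = R.toDatum) :
    M.sB.d42.IrreducibleSmooth ∧ (∀ v, 0 < (M.sB.d42.splitDatum v).n) ∧
      M.sB.d42.TypeIISizes ∧ M.sB.d42.FirstLift :=
  R.props_of_eq hR

/-- THE N4.2 BLOCK OF A COMPOSITION ON SIDE A in the rich form: the two displays and the one
construction binder give `ThetaNonzeroEverywhere` of the carrier's side-A datum. -/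
theorem N42_side_rich₃ (M : NAut3 F P) (hR : M.sA.d42 = R.toDatum)
    (hM : ∀ v, Hyp.Minguez2008_Theoreme1_2 (M.sA.d42.splitDatum v))
    (hGI : ∀ v, Hyp.GanIchino2014_Prop5_3_i (M.sA.d42.towerDatum v)) :
    M.sA.d42.ThetaNonzeroEverywhere :=
  R.thetaNonzeroEverywhere_of_eq hR hM hGI

/-- The same on side B. -/
theorem N42_sideB_rich₃ (M : NAut3 F P) (hR : M.sB.d42 = R.toDatum)
    (hM : ∀ v, Hyp.Minguez2008_Theoreme1_2 (M.sB.d42.splitDatum v))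
    (hGI : ∀ v, Hyp.GanIchino2014_Prop5_3_i (M.sB.d42.towerDatum v)) :
    M.sB.d42.ThetaNonzeroEverywhere :=
  R.thetaNonzeroEverywhere_of_eq hR hM hGI

/-! ### The toy instance (§10.5(ii)(c)/(d)) -/

/-- The rich datum of the N4.2 toy: `N42Toy.toyFinitePlaces` with its four facts as landed in
T6N42Toy (one split place with the toy type II datum `(2, 3)`, one non-split place with the toy
tower and `β′ = 1`). -/
def toy : N42Rich where
  d := toyFinitePlaces
  irreducibleSmooth :=
    ⟨fun _ => ⟨toyPair_irreducible, toyPair_smooth⟩, fun _ => ⟨trivial_irreducible, trivial_smooth⟩⟩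
  pos _ := Nat.zero_lt_succ 1
  typeIISizes _ := Nat.le_succ 2
  firstLift _ := toyTower_firstLift

/-- `toy.toDatum` is the toy finite-places datum (`rfl`) — the `d42` of `N42ToyNSide.toyNSide` and
of t6-p6's `N43Toy.bergmanNSide` (both `rfl`), so on the joint toys the construction binder is
`rfl`. -/
theorem toy_toDatum : toy.toDatum = toyFinitePlaces := rfl

/-- `N42_main` on the toy through the rich form (the landed `toyFinitePlaces_thetaNonzeroEverywhere`
re-derived from the instance). -/
theorem toy_thetaNonzeroEverywhere : toyFinitePlaces.ThetaNonzeroEverywhere :=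
  toy.thetaNonzeroEverywhere (fun _ => toyTypeII_minguez) (fun _ => toyTower_ganIchino)

end N42Rich

end Summit.Ventures.HodgeRepro2.T6
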